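import Summits.QuantumFields.YangMills.Theorems.BalabanLadderUVSeamRecCeilingsResponseCarriersUnit
import HarnessLib

/-!
# Crux `UVSeamRec` (stmt-QuantumFields-20043): the carriers press-buttons with CUBE-DEPENDENT carrier bounds

Helper file (`--supports stmt-QuantumFields-20043`) of the width-lever seat `ym-20043-ceilings-p2` (lane B, gen 2); a variant of p535725
`…CeilingsResponseCarriers.lean` / p539259 `…CeilingsResponseCarriersUnit.lean` in which the boundedness of the carriers (used only for
integrability on the finite torus) may depend on the cube: `|Y k β R q x η| ≤ MY β R q x`.  Reason: the typed large-field carrier of the (β)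
architecture, tempered-d1's `PolymerData.influenceAt` (p533172), is bounded by `coeffMass 𝔟 (kmax β R) R x` — a bound stated pointwise in the
cube position `x` (`abs_influenceAt_le`); with this variant it plugs in with NO further counting lemma.  HONEST FRAMING: composition only;
the carriers' laws are OPEN; nothing of E0′; not a gap, not Clay.

* `responseMoments_of_carriers_local`, `responseMoments_of_quadratic_and_polymerLaw_local` — as in p535725, cube-dependent bounds.
* `responseMomentsOdd6_of_quadratic_and_polymerLaw_local` — at the registered v5(α) stub (SU(2), `fundamentalLatticeRep 2`,
  `Transport.uRec`), as in p539259.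

References: as p535725 (Georgii (2011) Thm. 4.17 for the DLR part).
-/

set_option autoImplicit false

noncomputable section

open MeasureTheory Filter Topology Finset
open Literature.Probability.LatticeModels
open Literature.MathematicalPhysics.QuantumFieldTheory (GaugeConfig wilsonMeasure isProbabilityMeasure_wilsonMeasure
  measurable_torusLift LatticeRep)
open Literature.MathematicalPhysics.QuantumLattice

namespace Summit.QuantumFields.YangMills.Cruxes.UVSeamRec.TemperedResponse

section Route

open Summit.QuantumFields.YangMills.Cruxes.OSLegsFromFemtoAndGap.DlrCollarTransfer
open Summit.QuantumFields.YangMills.Cruxes.UV.TorusClass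
open Summit.QuantumFields.YangMills.Cruxes.UVSeamRec.PolymerRarity
open Summit.QuantumFields.YangMills.Cruxes.UVSeamRec.DefectCollar (integral_prod_indicator_eq_measureReal)

variable {G : Type} [Group G] [TopologicalSpace G] [IsTopologicalGroup G] [CompactSpace G]
  [MeasurableSpace G] [BorelSpace G] (r : LatticeRep G) (a : ℝ → ℝ)

/-- **(RM) from CARRIERS.**  Data: `K ≥ 1` measurable carriers `Y k β R q x : LGConfig 4 G → ℝ` of the exterior of the
radius-`R+1` cube around `x` (orientation `q`), each bounded in absolute value by `MY β R q x` (a bound that may depend on the cube — e.g. tempered-d1's `coeffMass … x`); constants `C₁ > 0`, `A₀`,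
`B'`, `β₁`, `ℓ₁`; reference values `p q β`.  Hypotheses: (split) for `β ≥ β₁`, `1 ≤ R`, `R·a β ≤ ℓ₁`, `q.1 < q.2` and EVERY
exterior `η`, `(R⁴/C₁)|kerE_{x−(R+1),2R+3}(plane q x)(η) − p q β| ≤ A₀ + Σ_k Y k β R q x η`; (EM_K) for every carrier
`k`, on every odd torus `(ℤ/(2L+1))⁴` with `4R+8 ≤ L` and every cyclically `2R+4`-separated family and index set `T`,
`⟨exp(K·Σ_{i∈T} Y k β R (q i) (x i)∘lift)⟩_{2L+1,β} ≤ exp(B'·#T)`.  THEN (RM) holds VERBATIM (hypothesis `hRM` of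
p532025 `momentBounds6_of_responseMoments`) with `B = A₀ + B'`.  Proof: pointwise split, then AM–GM
`exp(Σ_k Z_k) ≤ (1/K)Σ_k exp(K Z_k)` with `Z_k = Σ_{i∈T} Y k … ∘lift`, integrate, average the K bounds.  No Hölder, no
independence of the carriers, no rate. [folklore] -/
theorem responseMoments_of_carriers_local {K : ℕ} (hK : 0 < K) {C₁ β₁ ℓ₁ A₀ B' : ℝ} {p : Fin 4 × Fin 4 → ℝ → ℝ}
    (Y : Fin K → ℝ → ℕ → Fin 4 × Fin 4 → (Fin 4 → ℤ) → LGConfig 4 G → ℝ) (MY : ℝ → ℕ → Fin 4 × Fin 4 → (Fin 4 → ℤ) → ℝ)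
    (hYm : ∀ k β R q x, Measurable (Y k β R q x)) (hYb : ∀ k β R q x η, |Y k β R q x η| ≤ MY β R q x)
    (hsplit : ∀ β : ℝ, β₁ ≤ β → ∀ R : ℕ, 1 ≤ R → (R : ℝ) * a β ≤ ℓ₁ →
      ∀ (q : Fin 4 × Fin 4) (x : Fin 4 → ℤ), q.1 < q.2 → ∀ η : LGConfig 4 G,
        (R : ℝ) ^ 4 / C₁ * |kerE G r β (fun k => x k - (R + 1)) (2 * R + 3) η (plane G r q x) - p q β| ≤
          A₀ + ∑ k, Y k β R q x η)
    (hEM : ∀ k : Fin K, ∀ β : ℝ, β₁ ≤ β → ∀ (L n : ℕ) (q : Fin n → Fin 4 × Fin 4) (x : Fin n → (Fin 4 → ℤ)) (R : ℕ),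
      (∀ i, (q i).1 < (q i).2) → 1 ≤ R → (R : ℝ) * a β ≤ ℓ₁ → 4 * R + 8 ≤ L →
      (∀ i j : Fin n, i ≠ j → ∃ k : Fin 4,
        (2 * (R : ℤ) + 4) ≤ |((((x i k - x j k : ℤ) : ZMod (2 * L + 1))).valMinAbs : ℤ)|) →
      ∀ T : Finset (Fin n),
        torusE G r β L (fun U => Real.exp ((K : ℝ) * ∑ i ∈ T, Y k β R (q i) (x i) U)) ≤ Real.exp (B' * T.card)) :
    ∀ β : ℝ, β₁ ≤ β → ∀ (L n : ℕ) (q : Fin n → Fin 4 × Fin 4) (x : Fin n → (Fin 4 → ℤ)) (R : ℕ),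
      (∀ i, (q i).1 < (q i).2) → 1 ≤ R → (R : ℝ) * a β ≤ ℓ₁ → 4 * R + 8 ≤ L →
      (∀ i j : Fin n, i ≠ j → ∃ k : Fin 4,
        (2 * (R : ℤ) + 4) ≤ |((((x i k - x j k : ℤ) : ZMod (2 * L + 1))).valMinAbs : ℤ)|) →
      ∀ T : Finset (Fin n),
        torusE G r β L (fun U => Real.exp (∑ i ∈ T, (R : ℝ) ^ 4 / C₁ *
          |kerE G r β (fun k => x i k - (R + 1)) (2 * R + 3) U (plane G r (q i) (x i)) - p (q i) β|)) ≤
          Real.exp ((A₀ + B') * T.card) := by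
  intro β hβ L n q x R hq hR hRa hRL hsep T
  haveI := isProbabilityMeasure_wilsonMeasure (d := 4) (L := 2 * L + 1) r.ρ r.continuous β
  -- the carriers read on the torus
  set Z : Fin K → GaugeConfig 4 (2 * L + 1) G → ℝ :=
    fun k U => ∑ i ∈ T, Y k β R (q i) (x i) (torusLift (2 * L + 1) U) with hZdef
  have hZm : ∀ k, Measurable (Z k) := fun k =>
    Finset.measurable_sum T fun i _ => (hYm k β R (q i) (x i)).comp (measurable_torusLift _)
  have hZb : ∀ k U, |Z k U| ≤ ∑ i ∈ T, MY β R (q i) (x i) := fun k U => by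
    rw [hZdef]
    exact (Finset.abs_sum_le_sum_abs _ _).trans (Finset.sum_le_sum fun i _ => hYb k β R (q i) (x i) _)
  -- integrability of the K-fold exponentials (bounded measurable on a probability space)
  have hint : ∀ k, Integrable (fun U => Real.exp ((K : ℝ) * Z k U))
      (wilsonMeasure (d := 4) (L := 2 * L + 1) r.ρ β) := fun k => by
    refine integrable_of_abs_le ((hZm k).const_mul _).exp (C := Real.exp ((K : ℝ) * ∑ i ∈ T, MY β R (q i) (x i)))
      fun U => ?_
    rw [Real.abs_exp]
    exact Real.exp_le_exp.2 (mul_le_mul_of_nonneg_left ((le_abs_self _).trans (hZb k U)) (Nat.cast_nonneg _))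
  -- the K-fold moment bounds
  have hM : ∀ k, ∫ U, Real.exp ((K : ℝ) * Z k U) ∂(wilsonMeasure (d := 4) (L := 2 * L + 1) r.ρ β) ≤
      Real.exp (B' * T.card) := fun k => by
    have h := hEM k β hβ L n q x R hq hR hRa hRL hsep T
    simpa only [torusE, hZdef] using h
  -- AM–GM
  have havg := integral_exp_sum_le_of_forall (wilsonMeasure (d := 4) (L := 2 * L + 1) r.ρ β) hK Z hint hM
  -- pointwise split, summed over `T`
  have hsplit' : ∀ U : GaugeConfig 4 (2 * L + 1) G,
      Real.exp (∑ i ∈ T, (R : ℝ) ^ 4 / C₁ *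
        |kerE G r β (fun k => x i k - (R + 1)) (2 * R + 3) (torusLift (2 * L + 1) U) (plane G r (q i) (x i)) -
          p (q i) β|) ≤ Real.exp (A₀ * T.card) * Real.exp (∑ k, Z k U) := fun U => by
    rw [← Real.exp_add]
    refine Real.exp_le_exp.2 ?_
    calc ∑ i ∈ T, (R : ℝ) ^ 4 / C₁ *
          |kerE G r β (fun k => x i k - (R + 1)) (2 * R + 3) (torusLift (2 * L + 1) U) (plane G r (q i) (x i)) -
            p (q i) β|
        ≤ ∑ i ∈ T, (A₀ + ∑ k, Y k β R (q i) (x i) (torusLift (2 * L + 1) U)) :=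
          Finset.sum_le_sum fun i _ => hsplit β hβ R hR hRa (q i) (x i) (hq i) _
      _ = A₀ * T.card + ∑ k, Z k U := by
          rw [Finset.sum_add_distrib, Finset.sum_const, nsmul_eq_mul, Finset.sum_comm]
          ring
  -- integrate
  have hintR : Integrable (fun U => Real.exp (A₀ * T.card) * Real.exp (∑ k, Z k U))
      (wilsonMeasure (d := 4) (L := 2 * L + 1) r.ρ β) := by
    refine (integrable_of_abs_le (Finset.measurable_sum _ fun k _ => hZm k).exp
      (C := Real.exp (∑ _k : Fin K, ∑ i ∈ T, MY β R (q i) (x i))) fun U => ?_).const_mul _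
    rw [Real.abs_exp]
    exact Real.exp_le_exp.2 (Finset.sum_le_sum fun k _ => (le_abs_self _).trans (hZb k U))
  calc torusE G r β L (fun U => Real.exp (∑ i ∈ T, (R : ℝ) ^ 4 / C₁ *
          |kerE G r β (fun k => x i k - (R + 1)) (2 * R + 3) U (plane G r (q i) (x i)) - p (q i) β|))
      ≤ ∫ U, Real.exp (A₀ * T.card) * Real.exp (∑ k, Z k U) ∂(wilsonMeasure (d := 4) (L := 2 * L + 1) r.ρ β) := by
        unfold torusE
        exact integral_mono_of_nonneg (ae_of_all _ fun U => (Real.exp_pos _).le) hintR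
          (ae_of_all _ fun U => hsplit' U)
    _ = Real.exp (A₀ * T.card) * ∫ U, Real.exp (∑ k, Z k U) ∂(wilsonMeasure (d := 4) (L := 2 * L + 1) r.ρ β) :=
        integral_const_mul _ _
    _ ≤ Real.exp (A₀ * T.card) * Real.exp (B' * T.card) :=
        mul_le_mul_of_nonneg_left havg (Real.exp_pos _).le
    _ = Real.exp ((A₀ + B') * T.card) := by rw [← Real.exp_add]; ring_nf

/-- **(RM) from a QUADRATIC carrier with doubled joint exponential moments and a LARGE-FIELD carrier obeying the polymer
product law — the (β) discharge architecture of the v5 stub, abstract in its two carriers.**  Data: measurable carriers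
`Q β R q x` («`βR⁴|F_harm|²`-type») and `LF β R q x` («large-field correction») of the cube exterior, both bounded in
absolute value by `MY β R q x` (cube-dependent bounds allowed); constants `C₁ > 0`, `A₀`, `B_Q`, `Λ`, `W`; reference values `p`.  Hypotheses:
(split) `(R⁴/C₁)|kerE(plane)(η) − p| ≤ A₀ + Q(η) + LF(η)` for EVERY exterior; (EM_Q) `⟨exp(2 Σ_{i∈T} Q_i∘lift)⟩ ≤ e^{B_Q·#T}`
on every odd torus and separated family; (PL) per odd torus and separated family, polymer data `(κ, S, E, w, c)` with
`LF_i∘lift ≤ Σ_γ c_{iγ} 1_{E_γ}∘lift`, `Σ_i c_{iγ} ≤ Λ`, `Σ_γ c_{iγ} w_γ ≤ W` and the product law (p528131's typing with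
CONSTANT budgets).  THEN (RM) VERBATIM with `B = A₀ + max(B_Q, 2e^{2Λ}W)`.  The large-field half is a THEOREM at the
plaquette scale (p530009 `productLaw_largePlaquettes`); the quadratic half is the open Gaussian-domination input.
[folklore; suppliers of Bałaban's kind] -/
theorem responseMoments_of_quadratic_and_polymerLaw_local {C₁ β₁ ℓ₁ A₀ B_Q Λ W : ℝ} {p : Fin 4 × Fin 4 → ℝ → ℝ}
    (Q LF : ℝ → ℕ → Fin 4 × Fin 4 → (Fin 4 → ℤ) → LGConfig 4 G → ℝ) (MY : ℝ → ℕ → Fin 4 × Fin 4 → (Fin 4 → ℤ) → ℝ)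
    (hQm : ∀ β R q x, Measurable (Q β R q x)) (hQb : ∀ β R q x η, |Q β R q x η| ≤ MY β R q x)
    (hLFm : ∀ β R q x, Measurable (LF β R q x)) (hLFb : ∀ β R q x η, |LF β R q x η| ≤ MY β R q x)
    (hsplit : ∀ β : ℝ, β₁ ≤ β → ∀ R : ℕ, 1 ≤ R → (R : ℝ) * a β ≤ ℓ₁ →
      ∀ (q : Fin 4 × Fin 4) (x : Fin 4 → ℤ), q.1 < q.2 → ∀ η : LGConfig 4 G,
        (R : ℝ) ^ 4 / C₁ * |kerE G r β (fun k => x k - (R + 1)) (2 * R + 3) η (plane G r q x) - p q β| ≤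
          A₀ + Q β R q x η + LF β R q x η)
    (hEMQ : ∀ β : ℝ, β₁ ≤ β → ∀ (L n : ℕ) (q : Fin n → Fin 4 × Fin 4) (x : Fin n → (Fin 4 → ℤ)) (R : ℕ),
      (∀ i, (q i).1 < (q i).2) → 1 ≤ R → (R : ℝ) * a β ≤ ℓ₁ → 4 * R + 8 ≤ L →
      (∀ i j : Fin n, i ≠ j → ∃ k : Fin 4,
        (2 * (R : ℤ) + 4) ≤ |((((x i k - x j k : ℤ) : ZMod (2 * L + 1))).valMinAbs : ℤ)|) →
      ∀ T : Finset (Fin n),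
        torusE G r β L (fun U => Real.exp (((2 : ℕ) : ℝ) * ∑ i ∈ T, Q β R (q i) (x i) U)) ≤ Real.exp (B_Q * T.card))
    (hPL : ∀ β : ℝ, β₁ ≤ β → ∀ (L n : ℕ) (q : Fin n → Fin 4 × Fin 4) (x : Fin n → (Fin 4 → ℤ)) (R : ℕ),
      (∀ i, (q i).1 < (q i).2) → 1 ≤ R → (R : ℝ) * a β ≤ ℓ₁ → 4 * R + 8 ≤ L →
      (∀ i j : Fin n, i ≠ j → ∃ k : Fin 4,
        (2 * (R : ℤ) + 4) ≤ |((((x i k - x j k : ℤ) : ZMod (2 * L + 1))).valMinAbs : ℤ)|) →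
      ∃ (κ : Type) (S : Finset κ) (E : κ → Set (LGConfig 4 G)) (w : κ → ℝ) (c : Fin n → κ → ℝ),
        (∀ γ, MeasurableSet (E γ)) ∧ (∀ γ ∈ S, 0 ≤ w γ) ∧ (∀ i, ∀ γ ∈ S, 0 ≤ c i γ) ∧
        (∀ (i : Fin n) (U : GaugeConfig 4 (2 * L + 1) G),
          LF β R (q i) (x i) (torusLift (2 * L + 1) U) ≤
            ∑ γ ∈ S, c i γ * (E γ).indicator (fun _ => (1 : ℝ)) (torusLift (2 * L + 1) U)) ∧
        (∀ γ ∈ S, ∑ i, c i γ ≤ Λ) ∧ (∀ i, ∑ γ ∈ S, c i γ * w γ ≤ W) ∧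
        (∀ A, A ⊆ S → torusE G r β L (fun U => ∏ γ ∈ A, (E γ).indicator (fun _ => (1 : ℝ)) U) ≤
          ∏ γ ∈ A, w γ)) :
    ∀ β : ℝ, β₁ ≤ β → ∀ (L n : ℕ) (q : Fin n → Fin 4 × Fin 4) (x : Fin n → (Fin 4 → ℤ)) (R : ℕ),
      (∀ i, (q i).1 < (q i).2) → 1 ≤ R → (R : ℝ) * a β ≤ ℓ₁ → 4 * R + 8 ≤ L →
      (∀ i j : Fin n, i ≠ j → ∃ k : Fin 4,
        (2 * (R : ℤ) + 4) ≤ |((((x i k - x j k : ℤ) : ZMod (2 * L + 1))).valMinAbs : ℤ)|) →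
      ∀ T : Finset (Fin n),
        torusE G r β L (fun U => Real.exp (∑ i ∈ T, (R : ℝ) ^ 4 / C₁ *
          |kerE G r β (fun k => x i k - (R + 1)) (2 * R + 3) U (plane G r (q i) (x i)) - p (q i) β|)) ≤
          Real.exp ((A₀ + max B_Q (2 * Real.exp (2 * Λ) * W)) * T.card) := by
  -- the two carriers as a `Fin 2`-family
  set Y : Fin 2 → ℝ → ℕ → Fin 4 × Fin 4 → (Fin 4 → ℤ) → LGConfig 4 G → ℝ := ![Q, LF] with hYdef
  refine responseMoments_of_carriers_local r a (K := 2) (by norm_num) Y MY ?_ ?_ ?_ ?_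
  · intro k β R q x
    fin_cases k
    · simpa [hYdef] using hQm β R q x
    · simpa [hYdef] using hLFm β R q x
  · intro k β R q x η
    fin_cases k
    · simpa [hYdef] using hQb β R q x η
    · simpa [hYdef] using hLFb β R q x η
  · intro β hβ R hR hRa q x hq η
    have h := hsplit β hβ R hR hRa q x hq η
    simpa [hYdef, Fin.sum_univ_two, add_assoc] using h
  · intro k β hβ L n q x R hq hR hRa hRL hsep T
    fin_cases k
    · -- the quadratic carrier
      have h := hEMQ β hβ L n q x R hq hR hRa hRL hsep T
      refine (le_of_eq ?_).trans (h.trans (Real.exp_le_exp.2 ?_))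
      · simp [hYdef]
      · exact mul_le_mul_of_nonneg_right (le_max_left _ _) (Nat.cast_nonneg _)
    · -- the large-field carrier, from the product law
      obtain ⟨κ, S, E, w, c, hE, hw, hc, hdom, hΛ, hW, hpl⟩ := hPL β hβ L n q x R hq hR hRa hRL hsep
      have h := torusE_exp_two_mul_sum_le_of_polymerLaw r β L (fun i => LF β R (q i) (x i))
        S E w c hE hw hc hdom hΛ hW hpl T
      refine (le_of_eq ?_).trans (h.trans (Real.exp_le_exp.2 ?_))
      · simp [hYdef]
      · exact mul_le_mul_of_nonneg_right (le_max_right _ _) (Nat.cast_nonneg _)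

end Route

section Unit

open Summit.QuantumFields.YangMills.Cruxes.OSLegsFromFemtoAndGap.DlrCollarTransfer

variable [MeasurableSpace (Matrix.specialUnitaryGroup (Fin 2) ℂ)] [BorelSpace (Matrix.specialUnitaryGroup (Fin 2) ℂ)]

/-- **The body of `stub_responseMomentsOdd6` from the (β) split «quadratic + large-field carrier with polymer product law».**  At
`SU(2)`, fundamental representation, unit `a ≤ c·uRec` eventually: (split) `(R⁴/C₁)|kerE − p| ≤ A₀ + Q + LF` for ALL exteriors; (EM_Q)
`⟨exp(2ΣQ_i∘lift)⟩ ≤ e^{B_Q·#T}`; (PL) for LF with constant budgets Λ, W (p528131's typing) ⇒ the registered stub's conclusion with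
`B = A₀ + max(B_Q, 2e^{2Λ}W)` (p535725 `responseMoments_of_quadratic_and_polymerLaw`).  A closer of v5(α)'s stub along the (β)
architecture ends with `exact responseMomentsOdd6_of_quadratic_and_polymerLaw_local …` (cube-dependent carrier bounds). [folklore] -/
theorem responseMomentsOdd6_of_quadratic_and_polymerLaw_local {a : ℝ → ℝ} {c C₁ β₁ ℓ₁ A₀ B_Q Λ W P₀ : ℝ}
    {p : Fin 4 × Fin 4 → ℝ → ℝ} (hc : 0 < c) (hle : ∀ᶠ β in atTop, a β ≤ c * Transport.uRec β) (hℓ₁ : 0 < ℓ₁)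
    (hC₁ : 0 < C₁) (hp : ∀ q β, |p q β| ≤ P₀)
    (Q LF : ℝ → ℕ → Fin 4 × Fin 4 → (Fin 4 → ℤ) → LGConfig 4 (Matrix.specialUnitaryGroup (Fin 2) ℂ) → ℝ) (MY : ℝ → ℕ → Fin 4 × Fin 4 → (Fin 4 → ℤ) → ℝ)
    (hQm : ∀ β R q x, Measurable (Q β R q x)) (hQb : ∀ β R q x η, |Q β R q x η| ≤ MY β R q x)
    (hLFm : ∀ β R q x, Measurable (LF β R q x)) (hLFb : ∀ β R q x η, |LF β R q x η| ≤ MY β R q x)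
    (hsplit : ∀ β : ℝ, β₁ ≤ β → ∀ R : ℕ, 1 ≤ R → (R : ℝ) * a β ≤ ℓ₁ →
      ∀ (q : Fin 4 × Fin 4) (x : Fin 4 → ℤ), q.1 < q.2 → ∀ η : LGConfig 4 (Matrix.specialUnitaryGroup (Fin 2) ℂ),
        (R : ℝ) ^ 4 / C₁ * |kerE (Matrix.specialUnitaryGroup (Fin 2) ℂ) (fundamentalLatticeRep 2) β (fun k => x k - (R + 1)) (2 * R + 3) η
          (plane (Matrix.specialUnitaryGroup (Fin 2) ℂ) (fundamentalLatticeRep 2) q x) - p q β| ≤ A₀ + Q β R q x η + LF β R q x η)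
    (hEMQ : ∀ β : ℝ, β₁ ≤ β → ∀ (L n : ℕ) (q : Fin n → Fin 4 × Fin 4) (x : Fin n → (Fin 4 → ℤ)) (R : ℕ),
      (∀ i, (q i).1 < (q i).2) → 1 ≤ R → (R : ℝ) * a β ≤ ℓ₁ → 4 * R + 8 ≤ L →
      (∀ i j : Fin n, i ≠ j → ∃ k : Fin 4,
        (2 * (R : ℤ) + 4) ≤ |((((x i k - x j k : ℤ) : ZMod (2 * L + 1))).valMinAbs : ℤ)|) →
      ∀ T : Finset (Fin n),
        torusE (Matrix.specialUnitaryGroup (Fin 2) ℂ) (fundamentalLatticeRep 2) β L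
          (fun U => Real.exp (((2 : ℕ) : ℝ) * ∑ i ∈ T, Q β R (q i) (x i) U)) ≤ Real.exp (B_Q * T.card))
    (hPL : ∀ β : ℝ, β₁ ≤ β → ∀ (L n : ℕ) (q : Fin n → Fin 4 × Fin 4) (x : Fin n → (Fin 4 → ℤ)) (R : ℕ),
      (∀ i, (q i).1 < (q i).2) → 1 ≤ R → (R : ℝ) * a β ≤ ℓ₁ → 4 * R + 8 ≤ L →
      (∀ i j : Fin n, i ≠ j → ∃ k : Fin 4,
        (2 * (R : ℤ) + 4) ≤ |((((x i k - x j k : ℤ) : ZMod (2 * L + 1))).valMinAbs : ℤ)|) →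
      ∃ (κ : Type) (S : Finset κ) (E : κ → Set (LGConfig 4 (Matrix.specialUnitaryGroup (Fin 2) ℂ))) (w : κ → ℝ) (cf : Fin n → κ → ℝ),
        (∀ γ, MeasurableSet (E γ)) ∧ (∀ γ ∈ S, 0 ≤ w γ) ∧ (∀ i, ∀ γ ∈ S, 0 ≤ cf i γ) ∧
        (∀ (i : Fin n) (U : GaugeConfig 4 (2 * L + 1) (Matrix.specialUnitaryGroup (Fin 2) ℂ)),
          LF β R (q i) (x i) (torusLift (2 * L + 1) U) ≤
            ∑ γ ∈ S, cf i γ * (E γ).indicator (fun _ => (1 : ℝ)) (torusLift (2 * L + 1) U)) ∧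
        (∀ γ ∈ S, ∑ i, cf i γ ≤ Λ) ∧ (∀ i, ∑ γ ∈ S, cf i γ * w γ ≤ W) ∧
        (∀ A, A ⊆ S → torusE (Matrix.specialUnitaryGroup (Fin 2) ℂ) (fundamentalLatticeRep 2) β L
          (fun U => ∏ γ ∈ A, (E γ).indicator (fun _ => (1 : ℝ)) U) ≤ ∏ γ ∈ A, w γ)) :
    ∃ (a : ℝ → ℝ) (c : ℝ) (C₁ B β₁ ℓ₁ P₀ : ℝ) (p : Fin 4 × Fin 4 → ℝ → ℝ), 0 < c ∧
      (∀ᶠ β in atTop, a β ≤ c * Transport.uRec β) ∧ 0 < ℓ₁ ∧ 0 < C₁ ∧ (∀ q β, |p q β| ≤ P₀) ∧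
      ∀ β : ℝ, β₁ ≤ β → ∀ (L n : ℕ) (q : Fin n → Fin 4 × Fin 4) (x : Fin n → (Fin 4 → ℤ)) (R : ℕ),
        (∀ i, (q i).1 < (q i).2) → 1 ≤ R → (R : ℝ) * a β ≤ ℓ₁ → 4 * R + 8 ≤ L →
        (∀ i j : Fin n, i ≠ j → ∃ k : Fin 4,
          (2 * (R : ℤ) + 4) ≤ |((((x i k - x j k : ℤ) : ZMod (2 * L + 1))).valMinAbs : ℤ)|) →
        ∀ T : Finset (Fin n),
          torusE (Matrix.specialUnitaryGroup (Fin 2) ℂ) (fundamentalLatticeRep 2) β L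
            (fun U => Real.exp (∑ i ∈ T, (R : ℝ) ^ 4 / C₁ *
              |kerE (Matrix.specialUnitaryGroup (Fin 2) ℂ) (fundamentalLatticeRep 2) β (fun k => x i k - (R + 1)) (2 * R + 3) U
                (plane (Matrix.specialUnitaryGroup (Fin 2) ℂ) (fundamentalLatticeRep 2) (q i) (x i)) - p (q i) β|)) ≤ Real.exp (B * T.card) :=
  ⟨a, c, C₁, A₀ + max B_Q (2 * Real.exp (2 * Λ) * W), β₁, ℓ₁, P₀, p, hc, hle, hℓ₁, hC₁, hp,
    responseMoments_of_quadratic_and_polymerLaw_local (fundamentalLatticeRep 2) a Q LF MY hQm hQb hLFm hLFb hsplit hEMQ hPL⟩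

end Unit

end Summit.QuantumFields.YangMills.Cruxes.UVSeamRec.TemperedResponse

end
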